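import Mathlib
import Summits.NavierStokesRegularity.NavierStokesRegularity.Theorems.WakeRatchetTailRatchetPostFiringLeadingEdge
import HarnessLib

/-!
# `WakeRatchet.TailRatchet` (stmt-NavierStokesRegularity-21808), door D4′ — unconditional UPPER bound of the
# firing clock from the energy line: `s_{N+1} ≤ max(σ_E, N log Λ + log(√E/c) + 1)`

Def-free support lemmas (MODEL lattice ODEs: the scalar dyadic member of Tao 2016 §1.2 / §4 in the renormalised
variables of §6.4; nothing here concerns the Navier–Stokes equations; stmt-21808 is neither proved nor refuted here
and no stub of skeleton d00b85951d7c is closed).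

SETTING as in `WakeRatchetTailRatchetPostFiringLeadingEdge` (`Λ > 1`, `0 ≤ W ≤ B`, quiet start, lower rate at
level `c`, `Λc ≤ 1`, first-firing clock `s`).

* `firstFiring_succ_le_of_energy_line` — if at a log-time `σ ≥ σ_E > A` the energy line is below `c` at shell `N`
  (`Λ^N e^{−σ} √E(σ_E) < c`), then shell `N+1` has fired by `σ`: `s (N+1) ≤ σ` (shells `0..N` are below `c` by
  `energy_line`, the lower rate lights a shell `> N`, firing order);
* `firstFiring_succ_le_log` — explicitly, `s (N+1) ≤ max σ_E (N log Λ + log(√E(σ_E)/c) + 1)`.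

With `…PostFiringSpeedLimit` this brackets the clock unconditionally:
`m·c(1−Λc)/(ΛB²) ≤ s_{N+2m} − s_N` and `s_{N+1} ≤ N log Λ + O(1)` — slopes `≍ ε₀⁴` and `log Λ` per shell against
the observed `T ≈ 0.73 log Λ` (census CENSUS-21808-leafhand4-g17.md); the matching-slope statement is (G)/(D).

HONEST FRAMING: elementary; (D)/(QT)/(G) are NOT proved here; rung 0.
-/

noncomputable section

set_option linter.dupNamespace false

namespace Summit.NavierStokesRegularity.NavierStokesRegularity.Theorems

namespace WakeRatchetDyadicPostFiring

open Set Filter Topology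
open WakeRatchetFiringClock

variable {Λ : ℝ} {W : ℤ → ℝ → ℝ} {A₀ A B c : ℝ}

/-- **The front is at least as fast as the energy line.**  If `σ ≥ σ_E > A` and `Λ^N e^{−σ} √E(σ_E) < c`, then
`s (N+1) ≤ σ`.
[cite: Tao2016AveragedNS, §1.2 (dyadic model, conserved energy), §4 Lemma 4.1 (4.8)/(4.10), §6.4; elementary] -/
theorem firstFiring_succ_le_of_energy_line (hΛ : 1 < Λ) (hA : A₀ < A) (hc : 0 < c) (hΛc : Λ * c ≤ 1)
    (hlaw : ∀ (n : ℤ) (σ : ℝ), A₀ < σ → HasDerivAt (W n)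
      (-(W n σ) + Λ * W (n - 1) σ ^ 2 - Λ⁻¹ * W n σ * W (n + 1) σ) σ)
    (hnn : ∀ (n : ℤ) (σ : ℝ), A ≤ σ → 0 ≤ W n σ) (hB : ∀ (n : ℤ) (σ : ℝ), A ≤ σ → W n σ ≤ B)
    (hneg : ∀ n : ℤ, n < 0 → ∀ σ : ℝ, A ≤ σ → W n σ = 0) (hstart : ∀ n : ℤ, 0 < n → W n A = 0)
    (hrate : ∀ σ : ℝ, A ≤ σ → ∃ n : ℤ, c ≤ W n σ)
    {s : ℕ → ℝ} (hs3 : ∀ (n : ℕ) (σ : ℝ), A ≤ σ → c ≤ W (n : ℤ) σ → s n ≤ σ)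
    {σE : ℝ} (hσE : A < σE) (N : ℕ) {σ : ℝ} (hσ : σE ≤ σ)
    (hline : Λ ^ N * Real.exp (-σ)
      * Real.sqrt (∑' j : ℕ, Λ⁻¹ ^ (2 * j) * (Real.exp (2 * σE) * W j σE ^ 2)) < c) :
    s (N + 1) ≤ σ := by
  have hΛ0 : 0 < Λ := by linarith
  have hσA : A ≤ σ := hσE.le.trans hσ
  -- shells `m ≤ N` are below `c` at `σ`
  have hquiet : ∀ m : ℕ, m ≤ N → W (m : ℤ) σ < c := by
    intro m hm
    have h := energy_line hΛ hA hlaw hnn hB hneg hσE hσ m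
    have hpow : Λ ^ m ≤ Λ ^ N := pow_le_pow_right₀ hΛ.le hm
    calc W (m : ℤ) σ ≤ Λ ^ m * Real.exp (-σ)
          * Real.sqrt (∑' j : ℕ, Λ⁻¹ ^ (2 * j) * (Real.exp (2 * σE) * W j σE ^ 2)) := h
      _ ≤ Λ ^ N * Real.exp (-σ)
          * Real.sqrt (∑' j : ℕ, Λ⁻¹ ^ (2 * j) * (Real.exp (2 * σE) * W j σE ^ 2)) := by gcongr
      _ < c := hline
  -- the lit shell has index `N + 1 + d`
  obtain ⟨n, hn⟩ := hrate σ hσA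
  have hn0 : 0 ≤ n := nonneg_of_fire hc hneg hσA hn
  obtain ⟨d', hd'⟩ : ∃ d' : ℕ, (d' : ℤ) = n := ⟨n.toNat, Int.toNat_of_nonneg hn0⟩
  have hNd : N < d' := by
    by_contra hle
    push Not at hle
    have := hquiet d' hle
    rw [hd'] at this
    linarith
  obtain ⟨d, rfl⟩ : ∃ d : ℕ, d' = (N + 1) + d := ⟨d' - (N + 1), by omega⟩
  rw [← hd'] at hn
  obtain ⟨τ, hτA, hτσ, hτc⟩ := exists_fired_below hΛ0 hA hc hΛc hlaw hnn hstart (N + 1) d hσA hn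
  exact (hs3 (N + 1) τ hτA hτc).trans hτσ

/-- **Explicit clock upper bound.**  `s (N+1) ≤ max σ_E (N log Λ + log(√E(σ_E)/c) + 1)` for every `N`.
[cite: Tao2016AveragedNS, §1.2, §4 Lemma 4.1 (4.8)/(4.10), §6.4; elementary] -/
theorem firstFiring_succ_le_log (hΛ : 1 < Λ) (hA : A₀ < A) (hc : 0 < c) (hΛc : Λ * c ≤ 1)
    (hlaw : ∀ (n : ℤ) (σ : ℝ), A₀ < σ → HasDerivAt (W n)
      (-(W n σ) + Λ * W (n - 1) σ ^ 2 - Λ⁻¹ * W n σ * W (n + 1) σ) σ)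
    (hnn : ∀ (n : ℤ) (σ : ℝ), A ≤ σ → 0 ≤ W n σ) (hB : ∀ (n : ℤ) (σ : ℝ), A ≤ σ → W n σ ≤ B)
    (hneg : ∀ n : ℤ, n < 0 → ∀ σ : ℝ, A ≤ σ → W n σ = 0) (hstart : ∀ n : ℤ, 0 < n → W n A = 0)
    (hrate : ∀ σ : ℝ, A ≤ σ → ∃ n : ℤ, c ≤ W n σ)
    {s : ℕ → ℝ} (hs3 : ∀ (n : ℕ) (σ : ℝ), A ≤ σ → c ≤ W (n : ℤ) σ → s n ≤ σ)
    {σE : ℝ} (hσE : A < σE) (N : ℕ) :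
    s (N + 1) ≤ max σE ((N : ℝ) * Real.log Λ
      + Real.log (Real.sqrt (∑' j : ℕ, Λ⁻¹ ^ (2 * j) * (Real.exp (2 * σE) * W j σE ^ 2)) / c) + 1) := by
  have hΛ0 : 0 < Λ := by linarith
  set R : ℝ := Real.sqrt (∑' j : ℕ, Λ⁻¹ ^ (2 * j) * (Real.exp (2 * σE) * W j σE ^ 2)) with hR
  have hR0 : 0 ≤ R := Real.sqrt_nonneg _
  set σ : ℝ := max σE ((N : ℝ) * Real.log Λ + Real.log (R / c) + 1) with hσdef
  refine firstFiring_succ_le_of_energy_line hΛ hA hc hΛc hlaw hnn hB hneg hstart hrate hs3 hσE N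
    (le_max_left _ _) ?_
  change Λ ^ N * Real.exp (-σ) * R < c
  rcases hR0.eq_or_lt with hR00 | hRpos
  · rw [← hR00, mul_zero]; exact hc
  · -- `Λ^N e^{−σ} R ≤ Λ^N e^{−σ*} R = c/e < c`
    have hRc : 0 < R / c := div_pos hRpos hc
    have hσ' : (N : ℝ) * Real.log Λ + Real.log (R / c) + 1 ≤ σ := le_max_right _ _
    have hexp : Real.exp (-σ) ≤ Real.exp (-((N : ℝ) * Real.log Λ + Real.log (R / c) + 1)) :=
      Real.exp_le_exp.2 (by linarith)
    have hval : Λ ^ N * Real.exp (-((N : ℝ) * Real.log Λ + Real.log (R / c) + 1)) * R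
        = c * Real.exp (-1) := by
      have e1 : Real.exp (-((N : ℝ) * Real.log Λ + Real.log (R / c) + 1))
          = (Real.exp ((N : ℝ) * Real.log Λ))⁻¹ * (R / c)⁻¹ * Real.exp (-1) := by
        rw [show -((N : ℝ) * Real.log Λ + Real.log (R / c) + 1)
            = -((N : ℝ) * Real.log Λ) + -Real.log (R / c) + -1 by ring,
          Real.exp_add, Real.exp_add, Real.exp_neg, Real.exp_neg, Real.exp_log hRc]
      have e2 : Real.exp ((N : ℝ) * Real.log Λ) = Λ ^ N := by
        rw [← Real.log_pow, Real.exp_log (pow_pos hΛ0 N)]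
      rw [e1, e2]
      field_simp
    have hlt : c * Real.exp (-1) < c := by
      have h1 : Real.exp (-1) < 1 := by
        have h := Real.exp_lt_exp.2 (show (-1 : ℝ) < 0 by norm_num)
        rwa [Real.exp_zero] at h
      nlinarith
    calc Λ ^ N * Real.exp (-σ) * R ≤ Λ ^ N * Real.exp (-((N : ℝ) * Real.log Λ + Real.log (R / c) + 1)) * R := by
          gcongr
      _ = c * Real.exp (-1) := hval
      _ < c := hlt

end WakeRatchetDyadicPostFiring

end Summit.NavierStokesRegularity.NavierStokesRegularity.Theorems

end
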